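import Summits.AtomisticToContinuum.HydrodynamicLimit.Theorems.EquilibriumClampedCollisionalWindowLD.Negative.LatticeDev
import Summits.AtomisticToContinuum.HydrodynamicLimit.Theorems.EquilibriumClampedCollisionalWindowLD.Negative.PulseWindow

/-!
# The line lattice: separation of all pairs along the certificate (helper file of the refutation of `EquilibriumClampedCollisionalWindowLD`, stmt-AtomisticToContinuum-13733; see `Cruxes/EquilibriumClampedCollisionalWindowLD/Disproof.lean` and the evidence WITNESS.md; no Theses declaration is asserted positively; refuter-cdisprove-stmt-AtomisticToContinuum-13733-0)
-/

noncomputable section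

open Real
open scoped InnerProductSpace

namespace Summit.AtomisticToContinuum.HydrodynamicLimit.Theorems

namespace EquilibriumClampedCollisionalWindowLDNegative

section Lattice

open Literature.Analysis.FluidPDE Literature.Analysis.FunctionSpaces
open Filter
open scoped Topology

namespace Lat

variable {Λ : Lat} {N : ℕ} {a : Fin (N + 1) ≃ Λ.Slot}

/-! ### Integer-distance lemmas for the two kinds of far pairs -/

/-- **Longitudinal separation** (same line, different blocks): the coordinate difference is at
distance `≥ s - 2 eA` from every integer. [folklore] -/
theorem long_coord_sep {M : ℕ} (hM : 4 ≤ M) {s eA fw e1 : ℝ} (hs : s * M = 1)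
    (he1 : 0 ≤ e1) (he1A : e1 ≤ eA) (hAf : eA ≤ fw) (hfe : 2 * (fw + eA) ≤ s)
    {i i' : ℕ} (hi : i < M) (hi' : i' < M) (hne : i ≠ i')
    {x x' B B' : ℝ} (hx1 : -eA ≤ x - i * s) (hx2 : x - i * s ≤ B) (hx1' : -eA ≤ x' - i' * s)
    (hx2' : x' - i' * s ≤ B') (hB : B ≤ fw) (hB' : B' ≤ fw)
    (hadj1 : i' = i + 1 → B ≤ e1) (hadj2 : i = i' + 1 → B' ≤ e1)
    (hwrap1 : i' = 0 → i + 1 = M → B ≤ e1) (hwrap2 : i = 0 → i' + 1 = M → B' ≤ e1) :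
    ∃ k₀ : ℤ, s - 2 * eA ≤ (x' - x) - k₀ ∧ (x' - x) - k₀ ≤ 1 - (s - 2 * eA) := by
  have hM0 : (0 : ℝ) < M := by exact_mod_cast (show 0 < M by omega)
  have hs0 : 0 < s := by
    by_contra h; push Not at h
    have : s * M ≤ 0 := mul_nonpos_of_nonpos_of_nonneg h hM0.le
    linarith
  have hMs : (M : ℝ) * s = 1 := by rw [mul_comm]; exact hs
  have hM4 : (4 : ℝ) ≤ M := by exact_mod_cast hM
  have hs4 : 4 * s ≤ 1 := by nlinarith
  have heA : 0 ≤ eA := he1.trans he1A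
  -- products of index facts with `s`
  have prod : ∀ {u v : ℝ}, u ≤ v → u * s ≤ v * s := fun h => mul_le_mul_of_nonneg_right h hs0.le
  rcases Nat.lt_or_gt_of_ne hne with hlt | hgt
  · -- `i < i'`: no integer shift
    refine ⟨0, ?_, ?_⟩ <;> push_cast <;> rw [sub_zero]
    · rcases Nat.lt_or_ge i' (i + 2) with h1 | h2
      · have hi1 : i' = i + 1 := by omega
        have hB1 := hadj1 hi1
        have hc : (i' : ℝ) = i + 1 := by exact_mod_cast hi1
        have : (i' : ℝ) * s = i * s + s := by rw [hc]; ring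
        linarith
      · have hc : ((i : ℝ) + 2) ≤ i' := by exact_mod_cast h2
        have := prod hc
        have : ((i : ℝ) + 2) * s = i * s + 2 * s := by ring
        linarith
    · by_cases hw : i = 0 ∧ i' + 1 = M
      · have hB1 := hwrap2 hw.1 hw.2
        have h0 : (i : ℝ) = 0 := by exact_mod_cast hw.1
        have h1 : ((i' : ℝ) + 1) = M := by exact_mod_cast hw.2
        have : (i' : ℝ) * s = 1 - s := by
          have : ((i' : ℝ) + 1) * s = 1 := by rw [h1, hMs]
          linarith
        have : (i : ℝ) * s = 0 := by rw [h0, zero_mul]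
        linarith
      · have hle : i' + 2 ≤ i + M := by omega
        have hc : ((i' : ℝ) + 2) ≤ i + M := by exact_mod_cast hle
        have := prod hc
        have : ((i' : ℝ) + 2) * s = i' * s + 2 * s := by ring
        have : ((i : ℝ) + M) * s = i * s + 1 := by rw [add_mul, hMs]
        linarith
  · -- `i' < i`: shift by `-1`
    refine ⟨-1, ?_, ?_⟩ <;> push_cast <;> rw [sub_neg_eq_add]
    · by_cases hw : i' = 0 ∧ i + 1 = M
      · have hB1 := hwrap1 hw.1 hw.2
        have h0 : (i' : ℝ) = 0 := by exact_mod_cast hw.1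
        have h1 : ((i : ℝ) + 1) = M := by exact_mod_cast hw.2
        have : (i : ℝ) * s = 1 - s := by
          have : ((i : ℝ) + 1) * s = 1 := by rw [h1, hMs]
          linarith
        have : (i' : ℝ) * s = 0 := by rw [h0, zero_mul]
        linarith
      · have hle : i + 2 ≤ i' + M := by omega
        have hc : ((i : ℝ) + 2) ≤ i' + M := by exact_mod_cast hle
        have := prod hc
        have : ((i : ℝ) + 2) * s = i * s + 2 * s := by ring
        have : ((i' : ℝ) + M) * s = i' * s + 1 := by rw [add_mul, hMs]
        linarith
    · rcases Nat.lt_or_ge i (i' + 2) with h1 | h2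
      · have hi1 : i = i' + 1 := by omega
        have hB1 := hadj2 hi1
        have hc : (i : ℝ) = i' + 1 := by exact_mod_cast hi1
        have : (i : ℝ) * s = i' * s + s := by rw [hc]; ring
        linarith
      · have hc : ((i' : ℝ) + 2) ≤ i := by exact_mod_cast h2
        have := prod hc
        have : ((i' : ℝ) + 2) * s = i' * s + 2 * s := by ring
        linarith

/-- **Transverse separation** (different lines): the coordinate difference is at distance
`≥ 1/n - 2 fw` from every integer. [folklore] -/
theorem trans_coord_sep {n : ℕ} (hn : 0 < n) {fw : ℝ} {j j' : ℕ} (hj : j < n) (hj' : j' < n)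
    (hne : j ≠ j') {y y' : ℝ} (hy : |y - j / n| ≤ fw) (hy' : |y' - j' / n| ≤ fw) :
    ∃ k₀ : ℤ, (1 / n - 2 * fw) ≤ (y' - y) - k₀ ∧ (y' - y) - k₀ ≤ 1 - (1 / n - 2 * fw) := by
  have hn0 : (0 : ℝ) < n := by exact_mod_cast hn
  rw [abs_le] at hy hy'
  set c : ℝ := 1 / n with hc
  have h1n : 0 < c := by rw [hc]; positivity
  have hnn : (n : ℝ) * c = 1 := by rw [hc]; field_simp
  have hjn : (j : ℝ) / n = j * c := by rw [hc]; ring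
  have hjn' : (j' : ℝ) / n = j' * c := by rw [hc]; ring
  rw [hjn] at hy; rw [hjn'] at hy'
  have prod : ∀ {u v : ℝ}, u ≤ v → u * c ≤ v * c := fun h => mul_le_mul_of_nonneg_right h h1n.le
  rcases Nat.lt_or_gt_of_ne hne with hlt | hgt
  · refine ⟨0, ?_, ?_⟩ <;> push_cast <;> rw [sub_zero]
    · have h : ((j : ℝ) + 1) ≤ j' := by exact_mod_cast hlt
      have := prod h
      have : ((j : ℝ) + 1) * c = j * c + c := by ring
      linarith
    · have h : ((j' : ℝ) + 1) ≤ n := by exact_mod_cast hj'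
      have := prod h
      have : ((j' : ℝ) + 1) * c = j' * c + c := by ring
      have hj0 : (0 : ℝ) ≤ j * c := by positivity
      linarith
  · refine ⟨-1, ?_, ?_⟩ <;> push_cast <;> rw [sub_neg_eq_add]
    · have h : ((j : ℝ) + 1) ≤ n := by exact_mod_cast hj
      have := prod h
      have : ((j : ℝ) + 1) * c = j * c + c := by ring
      have hj0 : (0 : ℝ) ≤ j' * c := by positivity
      linarith
    · have h : ((j' : ℝ) + 1) ≤ j := by exact_mod_cast hgt
      have := prod h
      have : ((j' : ℝ) + 1) * c = j' * c + c := by ring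
      linarith

/-! ### Coordinates of slot vectors -/

/-- Coordinate `0` of a slot vector. [folklore] -/
@[simp] theorem slotVec_zero (ς : Λ.Slot) : Λ.slotVec ς 0 = (ς.1 : ℝ) * Λ.P.s := by
  simp [slotVec, lineVec, bv_apply]

/-- Coordinate `1` of a slot vector. [folklore] -/
@[simp] theorem slotVec_one (ς : Λ.Slot) : Λ.slotVec ς 1 = (ς.2.1 : ℝ) / Λ.n := by
  simp [slotVec, lineVec, bv_apply]

/-- Coordinate `2` of a slot vector. [folklore] -/
@[simp] theorem slotVec_two (ς : Λ.Slot) : Λ.slotVec ς 2 = (ς.2.2 : ℝ) / Λ.n := by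
  simp [slotVec, lineVec, bv_apply]

/-- Spheres of the same active block share the block frame. [folklore] -/
def SameBlk (Λ : Lat) (a : Fin (N + 1) ≃ Λ.Slot) (p q : Fin (N + 1)) : Prop :=
  Λ.Active (Λ.blk (a p)) ∧ Λ.blk (a p) = Λ.blk (a q) ∧ (a p).2 = (a q).2

/-- In the same active block, lifted positions differ by the block-local positions. [folklore] -/
theorem liftPos_sub_sameBlk (z : Cfg N) (t : ℝ) {p q : Fin (N + 1)} (h : Λ.SameBlk a p q) :
    Λ.liftPos a z t q - Λ.liftPos a z t p =
      pos Λ.P (bv 0) (Λ.bdata a z (Λ.blk (a p)) (a p).2) (Λ.loc (a q)) t -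
        pos Λ.P (bv 0) (Λ.bdata a z (Λ.blk (a p)) (a p).2) (Λ.loc (a p)) t := by
  obtain ⟨hact, hblk, hline⟩ := h
  rw [liftPos_active z t p hact, liftPos_active z t q (hblk ▸ hact), ← hblk, ← hline]
  abel

/-- Local indices of distinct spheres of the same block differ. [folklore] -/
theorem loc_ne_of_sameBlk {p q : Fin (N + 1)} (hpq : p ≠ q) (h : Λ.SameBlk a p q) : Λ.loc (a p) ≠ Λ.loc (a q) := by
  intro hl
  apply hpq
  apply a.injective
  have h1 := Λ.blk_mul_add_loc (a p)
  have h2 := Λ.blk_mul_add_loc (a q)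
  ext
  · rw [← h1, ← h2, h.2.1, hl]
  · rw [h.2.2]
  · rw [h.2.2]

/-- Block-local positions are small in the chart. [folklore] -/
theorem norm_pos_le (hW : Λ.WinOK) {z : Cfg N} (hz : z ∈ Λ.Ev a) {t : ℝ} (ht0 : 0 ≤ t) (htw : t ≤ Λ.w)
    (p : Fin (N + 1)) (hb : Λ.Active (Λ.blk (a p))) :
    ‖pos Λ.P (bv 0) (Λ.bdata a z (Λ.blk (a p)) (a p).2) (Λ.loc (a p)) t‖ < 1 / 4 := by
  have hdev := (liftPos_dev hW hz ht0 htw p).2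
  rw [liftPos_active z t p hb, Λ.slotVec_eq (a p)] at hdev
  have h : ‖pos Λ.P (bv 0) (Λ.bdata a z (Λ.blk (a p)) (a p).2) (Λ.loc (a p)) t -
      ((Λ.loc (a p) : ℝ) * Λ.P.s) • bv 0‖ ≤ Λ.P.fwd := by
    have : Λ.blockVec (Λ.blk (a p)) (a p).2 + pos Λ.P (bv 0) (Λ.bdata a z (Λ.blk (a p)) (a p).2) (Λ.loc (a p)) t -
        (Λ.blockVec (Λ.blk (a p)) (a p).2 + ((Λ.loc (a p) : ℝ) * Λ.P.s) • bv 0) =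
        pos Λ.P (bv 0) (Λ.bdata a z (Λ.blk (a p)) (a p).2) (Λ.loc (a p)) t - ((Λ.loc (a p) : ℝ) * Λ.P.s) • bv 0 := by
      abel
    rwa [this] at hdev
  have hκ : ‖((Λ.loc (a p) : ℝ) * Λ.P.s) • bv 0‖ ≤ (Λ.P.K : ℝ) * Λ.P.s := by
    rw [norm_smul, norm_bv, mul_one, Real.norm_of_nonneg (by have := hW.ok.sep.adm.s_pos; positivity)]
    have : (Λ.loc (a p) : ℝ) ≤ Λ.P.K := by exact_mod_cast loc_le_K hW.ok (a p)
    exact mul_le_mul_of_nonneg_right this hW.ok.sep.adm.s_pos.le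
  have hchart := hW.chart
  have hfwd : 0 ≤ Λ.P.fwd := (hW.ok.sep.adm.errA_nn).trans (e1_le_errA hW.ok.sep.adm).2
  have := norm_sub_norm_le (pos Λ.P (bv 0) (Λ.bdata a z (Λ.blk (a p)) (a p).2) (Λ.loc (a p)) t)
    (((Λ.loc (a p) : ℝ) * Λ.P.s) • bv 0)
  have hs := hW.ok.sep.adm.s_pos
  have hexp : ((Λ.P.K : ℝ) + 1) * Λ.P.s = (Λ.P.K : ℝ) * Λ.P.s + Λ.P.s := by ring
  linarith

/-- **Separation along the certificate**: on the window two distinct spheres are at minimal-image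
distance `> ε`, except for a transferring pair of an active block at its transfer time. [folklore] -/
theorem cert_sep (hW : Λ.WinOK) {z : Cfg N} (hz : z ∈ Λ.Ev a) {t : ℝ} (ht0 : 0 ≤ t) (htw : t ≤ Λ.w)
    {p q : Fin (N + 1)} (hpq : p ≠ q)
    (hnj : Λ.SameBlk a p q → t ∉ jumpTimes Λ.P (bv 0) (Λ.bdata a z (Λ.blk (a p)) (a p).2)) :
    Λ.P.ε < ‖(Torus.geometry (Fin 3)).sepVec (Λ.cert a z t p).1 (Λ.cert a z t q).1‖ := by
  classical
  have hΛ := hW.ok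
  have hP := hΛ.sep.adm
  rw [cert_fst, cert_fst]
  have hapq : a p ≠ a q := fun h => hpq (a.injective h)
  by_cases hline : (a p).2 = (a q).2
  · by_cases hsb : Λ.SameBlk a p q
    · -- same active block: the chart
      have hdiff := liftPos_sub_sameBlk z t hsb
      have hsmall : ‖Λ.liftPos a z t p - Λ.liftPos a z t q‖ < 1 / 2 := by
        rw [← norm_neg, neg_sub, hdiff]
        have h1 := norm_pos_le hW hz ht0 htw p hsb.1
        have h2 := norm_pos_le hW hz ht0 htw q (hsb.2.1 ▸ hsb.1)
        rw [← hsb.2.1, ← hsb.2.2] at h2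
        calc _ ≤ ‖pos Λ.P (bv 0) (Λ.bdata a z (Λ.blk (a p)) (a p).2) (Λ.loc (a q)) t‖ +
              ‖pos Λ.P (bv 0) (Λ.bdata a z (Λ.blk (a p)) (a p).2) (Λ.loc (a p)) t‖ := norm_sub_le _ _
          _ < 1 / 2 := by linarith
      rw [sepVec_proj_proj hsmall, ← norm_neg, neg_sub, hdiff]
      have hD := dataOK_of_mem hΛ hz hsb.1 (a p).2
      have hne := loc_ne_of_sameBlk hpq hsb
      have hwin : t < tHit Λ.P (bv 0) (Λ.bdata a z (Λ.blk (a p)) (a p).2) (Λ.P.K - 1) :=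
        lt_of_le_of_lt htw (w_lt_tHit hW hz hsb.1 (a p).2)
      have htT : t ≤ Λ.P.Tmax := htw.trans hW.w_le_T
      have hnotjump : ∀ {k l : ℕ}, l ≤ Λ.P.K → l = k + 1 → t ≠ tHit Λ.P (bv 0) (Λ.bdata a z (Λ.blk (a p)) (a p).2) l := by
        intro k l hl hlk heq
        rcases Nat.lt_or_ge l Λ.P.K with h | h
        · exact hnj hsb (heq ▸ tHit_mem_jumpTimes (by omega) h)
        · have hlK : l = Λ.P.K := le_antisymm hl h
          have h2 := tHit_mono hP hD (Nat.sub_le Λ.P.K 1) le_rfl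
          rw [hlK] at heq; linarith
      rcases lt_or_gt_of_ne hne with h | h
      · exact pair_sep hΛ.sep hD h (loc_le_K hΛ (a q)) ht0 htT hwin (fun hlk => hnotjump (loc_le_K hΛ (a q)) hlk)
      · rw [← norm_neg, neg_sub]
        exact pair_sep hΛ.sep hD h (loc_le_K hΛ (a p)) ht0 htT hwin (fun hlk => hnotjump (loc_le_K hΛ (a p)) hlk)
    · -- same line, different blocks: longitudinal
      have hi_ne : (a p).1.1 ≠ (a q).1.1 := by
        intro h; apply hapq; ext <;> [exact h; rw [hline]; rw [hline]]
      have he := e1_le_errA (Λ := Λ) hP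
      -- deviation data
      have hdp := liftPos_dev hW hz ht0 htw p
      have hdq := liftPos_dev hW hz ht0 htw q
      set Bp : ℝ := if Λ.Frozen (a p) then Λ.P.r + Λ.P.Tmax * Λ.P.u else Λ.P.fwd with hBp
      set Bq : ℝ := if Λ.Frozen (a q) then Λ.P.r + Λ.P.Tmax * Λ.P.u else Λ.P.fwd with hBq
      have hxp : (Λ.liftPos a z t p) 0 - ((a p).1.1 : ℝ) * Λ.P.s ≤ Bp := by
        have h0 : (Λ.liftPos a z t p) 0 - ((a p).1.1 : ℝ) * Λ.P.s = (Λ.liftPos a z t p - Λ.slotVec (a p)) 0 := by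
          simp
        rw [h0]
        by_cases hf : Λ.Frozen (a p)
        · rw [hBp, if_pos hf]
          exact (le_abs_self _).trans ((abs_apply_le_norm _ 0).trans (liftPos_dev_frozen hW hz ht0 htw hf))
        · rw [hBp, if_neg hf]; exact (le_abs_self _).trans ((abs_apply_le_norm _ 0).trans hdp.2)
      have hxq : (Λ.liftPos a z t q) 0 - ((a q).1.1 : ℝ) * Λ.P.s ≤ Bq := by
        have h0 : (Λ.liftPos a z t q) 0 - ((a q).1.1 : ℝ) * Λ.P.s = (Λ.liftPos a z t q - Λ.slotVec (a q)) 0 := by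
          simp
        rw [h0]
        by_cases hf : Λ.Frozen (a q)
        · rw [hBq, if_pos hf]
          exact (le_abs_self _).trans ((abs_apply_le_norm _ 0).trans (liftPos_dev_frozen hW hz ht0 htw hf))
        · rw [hBq, if_neg hf]; exact (le_abs_self _).trans ((abs_apply_le_norm _ 0).trans hdq.2)
      have hxp1 : -Λ.P.errA ≤ (Λ.liftPos a z t p) 0 - ((a p).1.1 : ℝ) * Λ.P.s := by
        have : (Λ.liftPos a z t p - Λ.slotVec (a p)) 0 = (Λ.liftPos a z t p) 0 - ((a p).1.1 : ℝ) * Λ.P.s := by simp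
        rw [← this]; exact hdp.1
      have hxq1 : -Λ.P.errA ≤ (Λ.liftPos a z t q) 0 - ((a q).1.1 : ℝ) * Λ.P.s := by
        have : (Λ.liftPos a z t q - Λ.slotVec (a q)) 0 = (Λ.liftPos a z t q) 0 - ((a q).1.1 : ℝ) * Λ.P.s := by simp
        rw [← this]; exact hdq.1
      have hBp_le : Bp ≤ Λ.P.fwd := by
        rw [hBp]; split_ifs <;> linarith [he.1, he.2]
      have hBq_le : Bq ≤ Λ.P.fwd := by
        rw [hBq]; split_ifs <;> linarith [he.1, he.2]
      have hBp_fr : Λ.Frozen (a p) → Bp ≤ Λ.P.r + Λ.P.Tmax * Λ.P.u := fun hf => by rw [hBp, if_pos hf]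
      have hBq_fr : Λ.Frozen (a q) → Bq ≤ Λ.P.r + Λ.P.Tmax * Λ.P.u := fun hf => by rw [hBq, if_pos hf]
      have hnot_pq : ¬ (Λ.Active (Λ.blk (a p)) ∧ Λ.blk (a p) = Λ.blk (a q)) := fun h => hsb ⟨h.1, h.2, hline⟩
      have hnot_qp : ¬ (Λ.Active (Λ.blk (a q)) ∧ Λ.blk (a q) = Λ.blk (a p)) := by
        rintro ⟨h1, h2⟩; exact hsb ⟨h2 ▸ h1, h2.symm, hline⟩
      have hM4 : 4 ≤ Λ.M := by
        have hs := hΛ.s_eq; have hs4 := hW.s_le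
        have hMpos := hΛ.M_pos
        have : (4 : ℝ) ≤ Λ.M := by
          rw [hs] at hs4
          have hM0 : (0:ℝ) < Λ.M := by exact_mod_cast hMpos
          rw [div_le_div_iff₀ hM0 (by norm_num)] at hs4
          linarith
        exact_mod_cast this
      have hsM : Λ.P.s * Λ.M = 1 := by
        rw [hΛ.s_eq]; have hM0 : (0:ℝ) < Λ.M := by exact_mod_cast hΛ.M_pos
        field_simp
      obtain ⟨k₀, h1, h2⟩ := long_coord_sep hM4 hsM (by have := hP.r_nn; have := hP.T_nn; have := hP.u_nn; positivity)
        he.1 he.2 hW.fe_le (a p).1.2 (a q).1.2 hi_ne hxp1 hxp hxq1 hxq hBp_le hBq_le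
        (fun h => hBp_fr (frozen_of_next hΛ h hnot_pq))
        (fun h => hBq_fr (frozen_of_next hΛ h hnot_qp))
        (fun _ h => hBp_fr (frozen_last h))
        (fun _ h => hBq_fr (frozen_last h))
      have hδ : Λ.P.ε < Λ.P.s - 2 * Λ.P.errA := by have := hW.long_sep; linarith
      refine hδ.trans_le (le_norm_sepVec_of_coord (i := 0) fun k => ?_)
      have := le_abs_sub_int k₀ h1 h2 (-k)
      rw [Int.cast_neg, sub_neg_eq_add] at this
      rwa [show (Λ.liftPos a z t p) 0 - (Λ.liftPos a z t q) 0 - (k : ℝ) =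
        -((Λ.liftPos a z t q) 0 - (Λ.liftPos a z t p) 0 + k) by ring, abs_neg]
  · -- different lines: transverse
    have hn := hΛ.n_pos
    have hdp := (liftPos_dev hW hz ht0 htw p).2
    have hdq := (liftPos_dev hW hz ht0 htw q).2
    have hδ : Λ.P.ε < 1 / Λ.n - 2 * Λ.P.fwd := by have := hW.trans_sep; linarith
    have hcoord : ∀ (r : Fin (N + 1)) (c : Fin 3), |(Λ.liftPos a z t r) c - (Λ.slotVec (a r)) c| ≤ Λ.P.fwd := by
      intro r c
      have := abs_apply_le_norm (Λ.liftPos a z t r - Λ.slotVec (a r)) c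
      simp only [PiLp.sub_apply] at this
      exact this.trans (liftPos_dev hW hz ht0 htw r).2
    by_cases h1 : (a p).2.1 = (a q).2.1
    · -- they differ in the third coordinate
      have h2 : (a p).2.2 ≠ (a q).2.2 := by
        intro h2; apply hline; exact Prod.ext h1 h2
      have hyp := hcoord p 2
      have hyq := hcoord q 2
      rw [slotVec_two] at hyp hyq
      obtain ⟨k₀, hk1, hk2⟩ := trans_coord_sep hn (a p).2.2.2 (a q).2.2.2 (fun h => h2 (Fin.ext h)) hyp hyq
      refine hδ.trans_le (le_norm_sepVec_of_coord (i := 2) fun k => ?_)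
      have := le_abs_sub_int k₀ hk1 hk2 (-k)
      rw [Int.cast_neg, sub_neg_eq_add] at this
      rwa [show (Λ.liftPos a z t p) 2 - (Λ.liftPos a z t q) 2 - (k : ℝ) =
        -((Λ.liftPos a z t q) 2 - (Λ.liftPos a z t p) 2 + k) by ring, abs_neg]
    · have hyp := hcoord p 1
      have hyq := hcoord q 1
      rw [slotVec_one] at hyp hyq
      obtain ⟨k₀, hk1, hk2⟩ := trans_coord_sep hn (a p).2.1.2 (a q).2.1.2 (fun h => h1 (Fin.ext h)) hyp hyq
      refine hδ.trans_le (le_norm_sepVec_of_coord (i := 1) fun k => ?_)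
      have := le_abs_sub_int k₀ hk1 hk2 (-k)
      rw [Int.cast_neg, sub_neg_eq_add] at this
      rwa [show (Λ.liftPos a z t p) 1 - (Λ.liftPos a z t q) 1 - (k : ℝ) =
        -((Λ.liftPos a z t q) 1 - (Λ.liftPos a z t p) 1 + k) by ring, abs_neg]

end Lat

end Lattice

end EquilibriumClampedCollisionalWindowLDNegative

end Summit.AtomisticToContinuum.HydrodynamicLimit.Theorems

end
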